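import Summits.QuantumFields.YangMills.Theorems.BalabanUVNodesN22W1PrintedBoxBlockAtDatum

/-!
# BalabanUVNodes ∕ node N22 = NE9 — THE NINE WINDOW CLAUSES OF dag-n22-c's ASSEMBLED RECORD J23 (`SliceInputsL2U.nonempty_of_blocks`: `hγ₂ hκ hPa hr₁ hPa1 hRb hTP hMvT hMvP` at
# print's forced threshold `rP = Rb = ε₁∕s₀`) DISCHARGED BY EXPLICIT, BASE-POINT-FREE LETTERS ON A COUPLING WINDOW `]0, γ]` — the SHARP small-window letters
# `T(γ) = e^{−½κε₁²∕γ²}∕γ²`, `TP(γ) = e^{−½γ₂((ε₁∕γ)² − r₁²)}∕γ²` (monotone branch `γ² ≤ ½κε₁²`, `γ² ≤ ½γ₂ε₁²`), and the window-free letters of p584099 §5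

Cell `pub-ymgap`, HUMAN RULING D-0062 (Track A) ∕ D-0149 (width seats), seat `pub-ymgap-dag-n22-w1` (WIDTH SEAT 1 of 3 on node n22), generation 0, file 8.  THEOREMS ONLY (0 `def`,
0 `sorry`); imports this seat's p585490 `…PrintedBoxBlockAtDatum` (`exp_neg_div_sq_le_window`, `boxTail_le_window`, `threshold_sq_window_le`, `surplus_le_window`; through it p584099's
`exp_neg_div_sq_le`, `boxTail_le_uniform`, `surplusTail_le_uniform`); restates nothing.  `--kind proof --supports stmt-QuantumFields-20544 --as helper` (K3⁷ `SpineGivenEndpointR13SepCoPH`).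

WHY.  dag-n22-c g11's J23 `YMDAG.N22.W1.SliceInputsL2U.nonempty_of_blocks` (p≈ `…SliceInputsL2UOfBlocks`, 2026-08-28) assembles the located record of ONE slice from the landed block
producers and keeps, from the box block, exactly NINE window clauses as displayed hypotheses at print's threshold (its lines `hγ₂ … hMvP`):
`0 ≤ γ₂`, `0 ≤ κ`, `a ≤ γ₂(ε₁∕s₀)²`, `P ≠ ∅ → r₁² ≤ (ε₁∕s₀)²`, `P ≠ ∅ → a ≤ γ₂r₁²`, `P = ∅ → e^{−½κ(ε₁∕s₀)²} ≤ T·s₀²`, `P ≠ ∅ → e^{−½γ₂((ε₁∕s₀)² − r₁²)} ≤ TP·s₀²`,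
`P = ∅ → 1 + T ≤ Mv`, `P ≠ ∅ → TP ≤ Mv`.  The knit J17-K asks the record for EVERY `s₀ ∈ Ioc 0 θ.γ` with `a`, `Mv` fixed.  THIS FILE names letters `T, TP, r₁` FREE OF THE BASE POINT
that satisfy the s₀-dependent clauses on the whole window, in TWO editions: (U) window-free (`T := (e·½κε₁²)⁻¹`, `TP := e^{½γ₂r₁²}(e·½γ₂ε₁²)⁻¹` — p584099 §5), valid for every `γ`; (S) SHARP
on small windows (`γ² ≤ ½κε₁²`, resp. `γ² ≤ ½γ₂ε₁²`): `T(γ) := e^{−½κε₁²∕γ²}∕γ²`, `TP(γ) := e^{−½γ₂((ε₁∕γ)² − r₁²)}∕γ²` — the letters that VANISH with the window, so that the knit's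
aperture numeral `(1−cP)⁻²·Mv·((1+cA)γ)² ≤ ½` can be met with `Mv := max (1 + T(γ)) (TP(γ))` on small windows; the remaining clauses read `a ≤ γ₂r₁²` and `r₁² ≤ (ε₁∕γ)²` (§2), i.e.
the ONE window numeral of the gain: `a ≤ γ₂·r₁² ≤ γ₂·(ε₁∕γ)²` — with STRICT room `γ₂((ε₁∕γ)² − r₁²) ≥ 2·log 2` if `TP(γ)·γ² ≤ ½` is wanted (§3).

HONEST FRAMING — what this is NOT.  Real-variable bookkeeping producing explicit letters; count-neutral; NOT a discharge of N22; whether the datum of record's `(a, Mv, θ.γ)` meet the resulting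
numerals is dag-n22-w2's window lane ∕ the record's (def-T ∕ plan) — not decided here; nothing of Bałaban's asserted.  One finite four-torus programme at fixed ε — R4 closes the conditional
rung `BalabanLadder.UV` only; NOT continuum, NOT OS, NOT a mass gap, NOT Clay.  0 `sorry`, standard axioms.

References (TYPES ∕ loci only): [I] = [Balaban1987RG1] §1 p. 263, (2.9) p. 266, (2.13) p. 268; [II] = [Balaban1988RG2Cluster] (2.3) p. 12, (2.22) p. 16.
-/

namespace Summit.QuantumFields.YangMills.BalabanUVNodes.N22PrintedBoxBlock

open Set
open scoped BigOperators

/-! ## §1 The sharp small-window surplus letter (large-field side) -/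

/-- **THE SHARP (2.22)-SURPLUS LETTER ON A SMALL WINDOW**: for `γ₂, ε > 0`, `0 ≤ r₁`, a window with `γ² ≤ ½γ₂ε²` and every `0 < s₀ ≤ γ`:
`e^{−½γ₂((ε∕s₀)² − r₁²)} ≤ TP(γ)·s₀²` with `TP(γ) := e^{−½γ₂((ε∕γ)² − r₁²)}∕γ²` (the monotone branch of `x ↦ e^{−c∕x}∕x`, p585490 `exp_neg_div_sq_le_window`).
[cite: Balaban1988RG2Cluster, (2.22) p.16; Balaban1987RG1, (2.13) p.268] -/
theorem surplusTail_le_window {γ₂ ε γ s₀ : ℝ} (r₁ : ℝ) (hs : 0 < s₀) (hsγ : s₀ ≤ γ) (hγ : γ ^ 2 ≤ γ₂ / 2 * ε ^ 2) :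
    Real.exp (-(γ₂ / 2 * ((ε / s₀) ^ 2 - r₁ ^ 2))) ≤ Real.exp (-(γ₂ / 2 * ((ε / γ) ^ 2 - r₁ ^ 2))) / γ ^ 2 * s₀ ^ 2 := by
  have hγ0 : 0 < γ := hs.trans_le hsγ
  have h := exp_neg_div_sq_le_window (c := γ₂ / 2 * ε ^ 2) hs hsγ hγ
  have hsplit : ∀ u : ℝ, Real.exp (-(γ₂ / 2 * ((ε / u) ^ 2 - r₁ ^ 2))) = Real.exp (γ₂ / 2 * r₁ ^ 2) * Real.exp (-(γ₂ / 2 * ε ^ 2 / u ^ 2)) := by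
    intro u
    rw [← Real.exp_add]
    congr 1
    rw [div_pow]
    ring
  rw [hsplit s₀, hsplit γ]
  calc Real.exp (γ₂ / 2 * r₁ ^ 2) * Real.exp (-(γ₂ / 2 * ε ^ 2 / s₀ ^ 2))
      ≤ Real.exp (γ₂ / 2 * r₁ ^ 2) * (Real.exp (-(γ₂ / 2 * ε ^ 2 / γ ^ 2)) / γ ^ 2 * s₀ ^ 2) := mul_le_mul_of_nonneg_left h (Real.exp_pos _).le
    _ = Real.exp (γ₂ / 2 * r₁ ^ 2) * Real.exp (-(γ₂ / 2 * ε ^ 2 / γ ^ 2)) / γ ^ 2 * s₀ ^ 2 := by ring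

/-! ## §2 The nine window clauses on `]0, γ]` with explicit base-point-free letters -/

/-- ★ **EDITION (U), WINDOW-FREE LETTERS**: for `κ, γ₂, ε₁ > 0`, any window radius `γ > 0`, any `r₁` with `r₁² ≤ (ε₁∕γ)²` and gain `a ≤ γ₂·r₁²`, the letters
`T := (e·½κε₁²)⁻¹`, `TP := e^{½γ₂r₁²}·(e·½γ₂ε₁²)⁻¹` and ANY `Mv ≥ max (1 + T) TP` satisfy J23's nine window clauses at EVERY base point `s₀ ∈ Ioc 0 γ` (the `P = ∅ ∕ P ≠ ∅` guards
dropped — each clause holds outright). [cite: Balaban1987RG1, (2.13) p.268 and §1 p.263; Balaban1988RG2Cluster, (2.22) p.16] -/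
theorem windowClauses_uniform {κ γ₂ ε₁ γ r₁ a Mv : ℝ} (hκ : 0 < κ) (hγ₂ : 0 < γ₂) (hε : 0 < ε₁)
    (hr₁γ : r₁ ^ 2 ≤ (ε₁ / γ) ^ 2) (ha : a ≤ γ₂ * r₁ ^ 2)
    (hMvT : 1 + (Real.exp 1 * (κ / 2 * ε₁ ^ 2))⁻¹ ≤ Mv) (hMvP : Real.exp (γ₂ / 2 * r₁ ^ 2) * (Real.exp 1 * (γ₂ / 2 * ε₁ ^ 2))⁻¹ ≤ Mv)
    {s₀ : ℝ} (hs₀ : s₀ ∈ Ioc (0 : ℝ) γ) :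
    0 ≤ γ₂ ∧ 0 ≤ κ ∧ a ≤ γ₂ * (ε₁ / s₀) ^ 2 ∧ r₁ ^ 2 ≤ (ε₁ / s₀) ^ 2 ∧ a ≤ γ₂ * r₁ ^ 2 ∧
      Real.exp (-(κ / 2 * (ε₁ / s₀) ^ 2)) ≤ (Real.exp 1 * (κ / 2 * ε₁ ^ 2))⁻¹ * s₀ ^ 2 ∧
      Real.exp (-(γ₂ / 2 * ((ε₁ / s₀) ^ 2 - r₁ ^ 2))) ≤ (Real.exp (γ₂ / 2 * r₁ ^ 2) * (Real.exp 1 * (γ₂ / 2 * ε₁ ^ 2))⁻¹) * s₀ ^ 2 ∧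
      1 + (Real.exp 1 * (κ / 2 * ε₁ ^ 2))⁻¹ ≤ Mv ∧ Real.exp (γ₂ / 2 * r₁ ^ 2) * (Real.exp 1 * (γ₂ / 2 * ε₁ ^ 2))⁻¹ ≤ Mv := by
  have hwin : r₁ ^ 2 ≤ (ε₁ / s₀) ^ 2 := hr₁γ.trans (threshold_sq_window_le hε.le hs₀.1 hs₀.2)
  exact ⟨hγ₂.le, hκ.le, ha.trans (mul_le_mul_of_nonneg_left hwin hγ₂.le), hwin, ha, boxTail_le_uniform hκ hε hs₀.1,
    surplusTail_le_uniform r₁ hγ₂ hε hs₀.1, hMvT, hMvP⟩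

/-- ★ **EDITION (S), SHARP SMALL-WINDOW LETTERS**: for `κ, γ₂, ε₁ > 0`, a window radius with `γ² ≤ ½κε₁²` and `γ² ≤ ½γ₂ε₁²`, any `0 ≤ r₁` with `r₁² ≤ (ε₁∕γ)²` and gain
`a ≤ γ₂·r₁²`, the letters `T(γ) := e^{−½κε₁²∕γ²}∕γ²`, `TP(γ) := e^{−½γ₂((ε₁∕γ)² − r₁²)}∕γ²` and ANY `Mv ≥ max (1 + T(γ)) (TP(γ))` satisfy the nine clauses at EVERY `s₀ ∈ Ioc 0 γ`
— these letters VANISH with the window (faster than any power), which is what the knit's aperture numeral needs. [cite: Balaban1987RG1, (2.13) p.268 and §1 p.263; Balaban1988RG2Cluster, (2.22) p.16] -/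
theorem windowClauses_sharp {κ γ₂ ε₁ γ r₁ a Mv : ℝ} (hκ : 0 < κ) (hγ₂ : 0 < γ₂) (hε : 0 < ε₁)
    (hγκ : γ ^ 2 ≤ κ / 2 * ε₁ ^ 2) (hγγ₂ : γ ^ 2 ≤ γ₂ / 2 * ε₁ ^ 2)
    (hr₁γ : r₁ ^ 2 ≤ (ε₁ / γ) ^ 2) (ha : a ≤ γ₂ * r₁ ^ 2)
    (hMvT : 1 + Real.exp (-(κ / 2 * ε₁ ^ 2 / γ ^ 2)) / γ ^ 2 ≤ Mv) (hMvP : Real.exp (-(γ₂ / 2 * ((ε₁ / γ) ^ 2 - r₁ ^ 2))) / γ ^ 2 ≤ Mv)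
    {s₀ : ℝ} (hs₀ : s₀ ∈ Ioc (0 : ℝ) γ) :
    0 ≤ γ₂ ∧ 0 ≤ κ ∧ a ≤ γ₂ * (ε₁ / s₀) ^ 2 ∧ r₁ ^ 2 ≤ (ε₁ / s₀) ^ 2 ∧ a ≤ γ₂ * r₁ ^ 2 ∧
      Real.exp (-(κ / 2 * (ε₁ / s₀) ^ 2)) ≤ Real.exp (-(κ / 2 * ε₁ ^ 2 / γ ^ 2)) / γ ^ 2 * s₀ ^ 2 ∧
      Real.exp (-(γ₂ / 2 * ((ε₁ / s₀) ^ 2 - r₁ ^ 2))) ≤ Real.exp (-(γ₂ / 2 * ((ε₁ / γ) ^ 2 - r₁ ^ 2))) / γ ^ 2 * s₀ ^ 2 ∧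
      1 + Real.exp (-(κ / 2 * ε₁ ^ 2 / γ ^ 2)) / γ ^ 2 ≤ Mv ∧ Real.exp (-(γ₂ / 2 * ((ε₁ / γ) ^ 2 - r₁ ^ 2))) / γ ^ 2 ≤ Mv := by
  have hwin : r₁ ^ 2 ≤ (ε₁ / s₀) ^ 2 := hr₁γ.trans (threshold_sq_window_le hε.le hs₀.1 hs₀.2)
  exact ⟨hγ₂.le, hκ.le, ha.trans (mul_le_mul_of_nonneg_left hwin hγ₂.le), hwin, ha, boxTail_le_window hs₀.1 hs₀.2 hγκ,
    surplusTail_le_window r₁ hs₀.1 hs₀.2 hγγ₂, hMvT, hMvP⟩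

/-! ## §3 Reading the sharp letters against the knit's aperture `Mv·γ² ≤ ½` -/

/-- If the sharp letters are to serve a vertex constant with `Mv·γ² ≤ ½` (a consequence of the knit's aperture numeral `(1−cP)⁻²·Mv·((1+cA)γ)² ≤ ½`), then the large-field
letter forces STRICT room in the gain numeral: `e^{−½γ₂((ε₁∕γ)² − r₁²)} ≤ ½`, i.e. `2·log 2 ≤ γ₂·((ε₁∕γ)² − r₁²)` — with `a ≤ γ₂r₁²` this is the window numeral
`a + 2·log 2 ≤ γ₂·(ε₁∕γ)²` of the J-road's box side. [cite: Balaban1987RG1, §1 p.263 («γ sufficiently small»); Balaban1988RG2Cluster, (2.22) p.16] -/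
theorem gain_room_of_aperture {γ₂ ε₁ γ r₁ a Mv : ℝ} (hγ : 0 < γ) (ha : a ≤ γ₂ * r₁ ^ 2)
    (hMvP : Real.exp (-(γ₂ / 2 * ((ε₁ / γ) ^ 2 - r₁ ^ 2))) / γ ^ 2 ≤ Mv) (hap : Mv * γ ^ 2 ≤ 1 / 2) :
    a + 2 * Real.log 2 ≤ γ₂ * (ε₁ / γ) ^ 2 := by
  have hγ2 : 0 < γ ^ 2 := by positivity
  have hexp : Real.exp (-(γ₂ / 2 * ((ε₁ / γ) ^ 2 - r₁ ^ 2))) ≤ 1 / 2 := by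
    have := (div_le_iff₀ hγ2).1 hMvP
    linarith
  -- `exp x ≤ ½ ⇒ x ≤ −log 2`
  have hx : -(γ₂ / 2 * ((ε₁ / γ) ^ 2 - r₁ ^ 2)) ≤ Real.log (1 / 2) := by
    rw [← Real.exp_le_exp, Real.exp_log (by norm_num : (0 : ℝ) < 1 / 2)]
    exact hexp
  rw [Real.log_div one_ne_zero two_ne_zero, Real.log_one, zero_sub] at hx
  linarith

end Summit.QuantumFields.YangMills.BalabanUVNodes.N22PrintedBoxBlock
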